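import Mathlib.LinearAlgebra.Matrix.Hermitian
import Literature.MathematicalPhysics.QuantumLattice.FinDimSpectrum
import Literature.MathematicalPhysics.QuantumLattice.HubbardModel
import Literature.MathematicalPhysics.QuantumLattice.HubbardHubbardModel
import HarnessLib

/-!
# Shastry's projected-pair inequalities for the Hubbard model (Sawada–Warke inequality)

Named facts (D-0014: `def … : Prop`, no `sorry`) transcribing B. S. Shastry, *Uncertainty principle
enhanced pairing correlations in projected Fermi systems near half filling*, J. Phys. A 30 (1997)
L635–L641 (arXiv:cond-mat/9612098), inequalities (2)–(5) of the text (labelled `ineq1`–`ineq4` in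
the arXiv source), for the PURE Hubbard model, i.e. at Shastry's projection coupling `U_s = 0`.

## Contents

* `sawadaWarke_inequality` — for a ground state `ψ₀` of a Hermitian matrix `H̃` (lowest eigenvalue on
  the whole space) and an arbitrary operator `M`: `re ⟨ψ₀, M† [H̃, M] ψ₀⟩ ≥ 0` (Sawada–Warke, Phys.
  Rev. 133 (1964) A1252, as used by Shastry, Ineq. (2) = `ineq1`).
* `uniformOnSitePair d L = B = Σ_x c_{x↓} c_{x↑}` (Shastry's `B = Σ_j e^{iφ_j} b_j`, `b_j = c_{j↓}c_{j↑}`,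
  case (α) `φ_j = 0`: the zero-momentum on-site singlet pair field) and
  `hoppingPairCommutator d L t = A = [T, B]` with `T` the hopping term (`= hubbardTorus d L t 0`);
  for nearest-neighbour hopping `A` "corresponds to the extended s-wave pairing operator"
  (`A = -2 Σ_k ε(k) b(k)`, Shastry p. 2).
* `shastry_pair_projection_inequalities` — for a ground state `ψ₀` of `H̃ = H(t,U) - μN` on the torus
  `(ℤ/Lℤ)^d` (Fock space, all particle numbers): `⟨B†A⟩ ≥ (U - 2μ) ⟨B†B⟩` (`ineq2` at `U_s = 0`) and,
  when `U - 2μ ≥ 0`, `⟨A†A⟩ ≥ (U - 2μ)² ⟨B†B⟩` (`ineq4` at `U_s = 0`, via Cauchy–Schwarz `ineq3`):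
  the extended-`s` pair correlation dominates the on-site one at the rate `((U - 2μ)/2t)²`.

## Why these are here (grounding note)

They ground the support item `EnslavedA1gLowerSandwich` (and the mechanism of `EnslavedA1gIdentity`,
`A1gSlavingTransfer`) of route `Summits/HubbardSuperconductivity/HubbardSuperconductivity/Theses/EnslavedA1g.lean`:
with `pairField sWave L = -√2 · B` and `[T, pairField sWave L] = 2t · pairField extendedSWave L`
(the route's `EnslavedA1gIdentity`, `d = 2`) the two inequalities read
`(U - 2μ) ‖P_s ψ‖² ≤ 2t re⟨P_s ψ, P_{s'} ψ⟩` and `(U - 2μ)² ‖P_s ψ‖² ≤ 4t² ‖P_{s'} ψ‖²`. The route item is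
the CANONICAL-SECTOR version (ψ a ground state in the `(N, S^z = 0)` sector and `2μ := E(N,0) - E(N-2,0)`),
whose hypothesis is weaker than "ground state of `H̃` on Fock space"; Shastry's three-line proof
(`⟨M†[H̃,M]⟩ = ⟨Mψ₀, (H̃ - Ẽ₀) Mψ₀⟩ ≥ 0`, `[H̃, B] = A - (U - 2μ) B`, Cauchy–Schwarz) goes through verbatim
with the variational principle in the sector `(N-2, 0)`; so the item is NOT a pure instantiation of the
printed fact, and the printed fact is vendored as printed (grounder discipline, D-0014).

## Design notes / deliberately not here

* Shastry's Hamiltonian (1) is `H = T + U Σ n↑n↓ + U_s B†B` on a `d`-dimensional hypercubic lattice; the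
  printed coefficient in `ineq2`/`ineq4` is `{U_s(𝓛 - N + 2) - 2μ + U}`. We transcribe the case `U_s = 0`
  (the pure Hubbard model `hubbardTorusWith d L t U μ`, periodic boundary conditions), where the particle
  number `N` of `ψ₀` drops out; the `U_s > 0` ("order by projection") statements, the uncertainty-principle
  bound (6) and the spin-model numerics are not transcribed.
* `ineq4` is printed without the proviso `U - 2μ ≥ 0`; it is obtained by squaring `ineq2`, which is only
  legitimate when the coefficient is nonnegative (Shastry: "the LHS of above is forced to be real and to be
  positive", with `U_s(𝓛 - N + 2)` large and positive). At `U_s = 0` the proviso is needed (atomic limit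
  `t = 0`, `2μ > U`: `A = 0 ≠ B ψ₀`), so it is made an explicit hypothesis here.
* "Ground state of `H̃`" is rendered as an eigenvector for the lowest Rayleigh quotient on the whole space,
  `H̃ ψ₀ = (H̃.minEnergyOn ⊤) ψ₀` (`Matrix.minEnergyOn`, `FinDimSpectrum.lean`); `ψ₀ = 0` makes both
  inequalities trivial (`0 ≤ 0`), so no non-vanishing clause is needed.
* Mathlib/tree search: `lean search` for `onSitePair` (Koma–Tasaki section of `HubbardHubbardModel.lean`,
  reused for `b_j`), `minEnergyOn`, `hubbardTorusWith`; nothing on Sawada–Warke or Shastry's inequalities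
  (`lean search -i "sawada|shastry"` finds only Kennedy–Lieb–Shastry 1988 on the XY model and Giga–Sawada on
  Navier–Stokes).

## Sources

B. S. Shastry, J. Phys. A 30 (1997) L635, arXiv:cond-mat/9612098 [Shastry1997];
K. Sawada, C. S. Warke, Phys. Rev. 133 (1964) A1252 (the inequality, as cited in [Shastry1997, ref. [sw]]);
C. N. Yang, PRL 63 (1989) 2144 [Yang1989] (the staggered case (β), where `A = 0`).
-/

noncomputable section

namespace Literature.MathematicalPhysics.QuantumLattice

open Matrix Finset
open scoped ComplexOrder

/-! ### The Sawada–Warke inequality -/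

/-- **Sawada–Warke inequality** (as used by Shastry, Ineq. (2) of the text): if `ψ₀` is a ground state
of the Hermitian matrix `H̃` — an eigenvector for its lowest energy on the whole space,
`H̃ ψ₀ = E₀ ψ₀` with `E₀ = H̃.minEnergyOn ⊤` — then for an ARBITRARY operator `M`,
`re ⟨ψ₀, M† [H̃, M] ψ₀⟩ ≥ 0`. ("The inequality is readily proved by inserting a complete set of
energy eigenfunctions": `⟨ψ₀, M†[H̃, M]ψ₀⟩ = ⟨Mψ₀, (H̃ - E₀) Mψ₀⟩ ≥ 0`.) Stated for complex matrices
on a finite index type, the setting of the tree's lattice-fermion operators.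
[cite: Shastry1997, Ineq. (2) and ref. [sw] (Sawada–Warke, Phys. Rev. 133 (1964) A1252)] -/
def sawadaWarke_inequality : Prop :=
  ∀ {n : Type} [Fintype n] [DecidableEq n] (H M : Matrix n n ℂ) (ψ₀ : n → ℂ),
    H.IsHermitian → H *ᵥ ψ₀ = ((H.minEnergyOn ⊤ : ℝ) : ℂ) • ψ₀ →
      0 ≤ (star ψ₀ ⬝ᵥ ((Mᴴ * (H * M - M * H)) *ᵥ ψ₀)).re

/-! ### Shastry's operators `B` and `A = [T, B]` on the torus `(ℤ/Lℤ)^d` -/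

section Torus

variable (d L : ℕ) [NeZero L]

/-- Shastry's uniform (zero-momentum) on-site pair annihilation field
`B = Σ_j b_j`, `b_j = c_{j↓} c_{j↑}` (case (α): all phases `φ_j = 0`), on the fermionic torus
`(ℤ/Lℤ)^d`; `b_j` is the tree's `onSitePair`. (Case (β), `φ_j = π·j`, is Yang's `η`.)
[cite: Shastry1997, eq. (1) and the definition of B below it] -/
def uniformOnSitePair :
    Matrix (Finset (Orb (FermionTorus d L))) (Finset (Orb (FermionTorus d L))) ℂ :=
  ∑ x : Literature.Probability.LatticeModels.TorusSite d L, onSitePair x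

/-- Shastry's operator `A = [T, B]`, the commutator of the HOPPING term `T` of the Hubbard Hamiltonian
(here `T = hubbardTorus d L t 0`, nearest-neighbour hopping of amplitude `t` on `(ℤ/Lℤ)^d`, i.e. the
Hamiltonian at `U = 0`) with the uniform on-site pair field `B`. In momentum space
`A = -2 Σ_k ε(k) b(k)`; for nearest-neighbour hopping on the hypercubic lattice "(α) corresponds to the
extended s-wave pairing operator". [cite: Shastry1997, text after Ineq. (3)] -/
def hoppingPairCommutator (t : ℝ) :
    Matrix (Finset (Orb (FermionTorus d L))) (Finset (Orb (FermionTorus d L))) ℂ :=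
  hubbardTorus d L t 0 * uniformOnSitePair d L - uniformOnSitePair d L * hubbardTorus d L t 0

end Torus

/-! ### Shastry's inequalities (3) and (5) at `U_s = 0` -/

/-- **Shastry's projected-pair inequalities for the pure Hubbard model.** Let `ψ₀` be a ground state
of the grand-canonical Hubbard Hamiltonian `H̃ = H(t, U) - μ N` on the torus `(ℤ/Lℤ)^d` (on the whole
Fock space: `H̃ ψ₀ = Ẽ₀ ψ₀`, `Ẽ₀ = H̃.minEnergyOn ⊤`), `B = Σ_j c_{j↓}c_{j↑}` the uniform on-site pair
field and `A = [T, B]` (`T` the hopping term). Then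
(i)  `re ⟨B ψ₀, A ψ₀⟩ ≥ (U - 2μ) ⟨B ψ₀, B ψ₀⟩` — Shastry's Ineq. (3) (`ineq2`),
`⟨B†A⟩ ≥ {U_s(𝓛 - N + 2) - 2μ + U} ⟨B†B⟩`, at projection coupling `U_s = 0` (it follows from the
Sawada–Warke inequality with `M = B` and `[H̃, B] = A - (U - 2μ) B`, using `[Σ n↑n↓, B] = -B`,
`[N, B] = -2B`); and
(ii) if `U - 2μ ≥ 0`, `⟨A ψ₀, A ψ₀⟩ ≥ (U - 2μ)² ⟨B ψ₀, B ψ₀⟩` — Shastry's Ineq. (5) (`ineq4`) at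
`U_s = 0`, from (i) and Cauchy–Schwarz (Ineq. (4)); the proviso `U - 2μ ≥ 0`, implicit in print, is
explicit here (see the module docstring). In words: in any such ground state the extended-`s` pair
correlation is at least `((U - 2μ)/2t)²` times the on-site one ("projecting out s-wave Cooper pairs"
enhances extended-`s` pairing). Grounds
`Summit.HubbardSuperconductivity.HubbardSuperconductivity.Theses.EnslavedA1g.EnslavedA1gLowerSandwich`
(canonical-sector variant, `2μ := E(N,0) - E(N-2,0)`; see the module docstring for the exact relation).
[cite: Shastry1997, Ineqs. (3)–(5) with U_s = 0] -/
def shastry_pair_projection_inequalities : Prop :=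
  ∀ (d L : ℕ) [NeZero L] (t U μ : ℝ) (ψ₀ : Fock (Orb (FermionTorus d L))),
    hubbardTorusWith d L t U μ *ᵥ ψ₀ =
        (((hubbardTorusWith d L t U μ).minEnergyOn ⊤ : ℝ) : ℂ) • ψ₀ →
      (U - 2 * μ) *
            (star (uniformOnSitePair d L *ᵥ ψ₀) ⬝ᵥ (uniformOnSitePair d L *ᵥ ψ₀)).re ≤
          (star (uniformOnSitePair d L *ᵥ ψ₀) ⬝ᵥ (hoppingPairCommutator d L t *ᵥ ψ₀)).re ∧
        (0 ≤ U - 2 * μ →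
          (U - 2 * μ) ^ 2 *
              (star (uniformOnSitePair d L *ᵥ ψ₀) ⬝ᵥ (uniformOnSitePair d L *ᵥ ψ₀)).re ≤
            (star (hoppingPairCommutator d L t *ᵥ ψ₀) ⬝ᵥ
                (hoppingPairCommutator d L t *ᵥ ψ₀)).re)

end Literature.MathematicalPhysics.QuantumLattice
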